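import Literature.NumberTheory.EllipticCurves.TwoDescent
import Literature.NumberTheory.EllipticCurves.ArchimedeanKummerImageMaximal
import HarnessLib

/-!
# T-42-mult in the kernel, Stage B II: over a real closed ordered field, `E(F) = 2E(F) + {O, T₃}` when
# all three points of order `2` are rational (`Δ_E > 0`)

Cell `bsd-2adic` (run/shared/lean/pub/bsd-2adic/), seat `bsd-2adic-t42` (BRIEF-T42, DESIGN-T42 §5 item
K-arch1, input (R⁺)): the real-algebra input of the archimedean local condition at `p = 2` when
`Δ_E > 0`. HONEST FRAMING: research route; theorems only (no `def`, no named fact, nothing booked).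

Let `F` be a linearly ordered field in which every positive element is a square (`F = ℝ`, or the
completion `ℚ_w ≅ ℝ` read through an order isomorphism), `E : y² + a₁xy + a₃y = x³ + …` a Weierstrass
curve over `F` whose `2`-division cubic splits, `4x³ + b₂x² + 2b₄x + b₆ = 4(x − e₁)(x − e₂)(x − e₃)`,
with `e₁ > e₂ > e₃` (the tree's `SplitTwoTorsion`, file `TwoDescent`), `Tᵢ = (eᵢ, ·)` the points of
order `2`. By the tree's complete `2`-descent (`twoDescentComponent`, kernel `2E(F)`, Silverman *AEC*
X.1.4 / Knapp Thm. 4.2, PROVED there for general Weierstrass equations):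
* `e_le_x_of_equation` — every affine `F`-point has `x ≥ e₃`, and `x ≥ e₁` or `x ≤ e₂` (the sign of
  `(x − e₁)(x − e₂)(x − e₃) = (y + (a₁x + a₃)/2)² ≥ 0`): the two real components;
* `twoDescentComponent_dichotomy` — the `2`-descent image of an `F`-point is `(1, 1)` (identity
  component) or `([−1], [−1]) = δ(T₃)` (the egg), in `Fˣ/Fˣ² = {[1], [−1]}`;
* **`exists_add_self_or_add_self_add`** — hence every `P ∈ E(F)` is `2Q` or `2Q + T₃` with `Q ∈ E(F)`
  ("`E(F)/2E(F) = ℤ/2` generated by `T₃`", Milne *ADT* I Rem. 3.7 / Silverman X.1.4 over `ℝ`), and the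
  iterate **`exists_pow_smul_eq_or`**: `P = 2ᵏQ` or `2ᵏQ + T₃`;
* `ne_add_self_T₃` — while `T₃ ∉ 2E(F)` (tree `add_self_ne_of_lt`).
These feed file Stage B III: at a real place of `ℚ_∞` the Kummer condition of `Sel_{2^∞}` is "locally
trivial", and the residual archimedean line is `C_∞[2] = ⟨T₃⟩` (Greenberg's "point of `E(ℝ)[2]` with
minimal `x`", LNM 1716 p. 174).

References: [SilvermanAEC2009] Prop. X.1.4, III.2.3(d); [Knapp1993] Thm. 4.2; [MilneADT2006] I Rem. 3.7;
[GreenbergLNM1716] §5 p. 168 and Remark p. 174; [Matsuno2008] Lemma 2.5, Prop. 4.4.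
-/

set_option autoImplicit false

set_option linter.dupNamespace false

noncomputable section

open scoped Classical

namespace Summit.BirchSwinnertonDyer.BirchSwinnertonDyer.Theorems.MultTransportAtTwo

open WeierstrassCurve WeierstrassCurve.Affine WeierstrassCurve.Affine.Point

section RealClosed

variable {F : Type*} [Field F] [LinearOrder F] [IsStrictOrderedRing F] [DecidableEq F]
  {W : Affine F} {e₁ e₂ e₃ : F}

/-! ## §1. Square classes in a field whose positive elements are squares -/

omit [IsStrictOrderedRing F] [DecidableEq F] in
/-- A positive element is a square class `1`. [folklore] -/
theorem sqClass_eq_one_of_pos (hsq : ∀ a : F, 0 < a → ∃ u : F, a = u ^ 2) {a : F} (ha : 0 < a) :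
    sqClass a = 1 :=
  (sqClass_eq_one_iff ha.ne').mpr (hsq a ha)

omit [DecidableEq F] in
/-- A negative element has the square class of `−1`. [folklore] -/
theorem sqClass_eq_of_neg (hsq : ∀ a : F, 0 < a → ∃ u : F, a = u ^ 2) {a : F} (ha : a < 0) :
    sqClass a = sqClass (-1 : F) := by
  have h : sqClass a = sqClass (-1 : F) * sqClass (-a) := by
    rw [← sqClass_mul (by norm_num) (neg_ne_zero.mpr ha.ne), neg_one_mul, neg_neg]
  rw [h, sqClass_eq_one_of_pos hsq (neg_pos.mpr ha), SqUnits.mul_one]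

/-! ## §2. The two real components: `x ≥ e₁` or `e₃ ≤ x ≤ e₂` -/

omit [DecidableEq F] in
/-- **An `F`-rational affine point has `x ≥ e₃`, and `x ≥ e₁` or `x ≤ e₂`** (`e₁ > e₂ > e₃` the
abscissae of the points of order `2`): `(x − e₁)(x − e₂)(x − e₃) = (y + (a₁x + a₃)/2)² ≥ 0`.
[cite: SilvermanAEC2009, Prop. X.1.4] -/
theorem e_le_x_of_equation (h : W.SplitTwoTorsion e₁ e₂ e₃) (h₁₂ : e₂ < e₁) (h₂₃ : e₃ < e₂) {x y : F}
    (hxy : W.Equation x y) : e₃ ≤ x ∧ (e₁ ≤ x ∨ x ≤ e₂) := by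
  have hsq := sq_eq_mul_mul_of_equation h hxy
  have hnn : 0 ≤ (x - e₁) * (x - e₂) * (x - e₃) := by rw [← hsq]; exact sq_nonneg _
  constructor
  · by_contra hlt
    rw [not_le] at hlt
    have h1 : x - e₁ < 0 := by linarith
    have h2 : x - e₂ < 0 := by linarith
    have h3 : x - e₃ < 0 := by linarith
    have : (x - e₁) * (x - e₂) * (x - e₃) < 0 := mul_neg_of_pos_of_neg (mul_pos_of_neg_of_neg h1 h2) h3
    linarith
  · by_contra hno
    push Not at hno
    have h1 : x - e₁ < 0 := by linarith
    have h2 : 0 < x - e₂ := by linarith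
    have h3 : 0 < x - e₃ := by linarith
    have : (x - e₁) * (x - e₂) * (x - e₃) < 0 := mul_neg_of_neg_of_pos (mul_neg_of_neg_of_pos h1 h2) h3
    linarith

/-! ## §3. The `2`-descent image of a real point: `(1, 1)` or `([−1], [−1])` -/

variable [W.IsElliptic]

omit [W.IsElliptic] in
/-- **The `2`-descent image of an `F`-point is `(1,1)` or `([−1],[−1])`**: on the identity component
(`x ≥ e₁`) both `x − e₁`, `x − e₂` are positive (at `T₁`: the conventional value
`(e₁ − e₂)(e₁ − e₃) > 0`), on the egg (`e₃ ≤ x ≤ e₂`) both are negative (at `T₂`, `T₃` likewise).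
[cite: SilvermanAEC2009, Prop. X.1.4] [cite: MilneADT2006, I Rem. 3.7] -/
theorem twoDescentComponent_dichotomy (h : W.SplitTwoTorsion e₁ e₂ e₃) (h₁₂ : e₂ < e₁) (h₂₃ : e₃ < e₂)
    (hsq : ∀ a : F, 0 < a → ∃ u : F, a = u ^ 2) (P : W.Point) :
    (twoDescentComponent W e₁ e₂ e₃ P = 1 ∧ twoDescentComponent W e₂ e₁ e₃ P = 1) ∨
      (twoDescentComponent W e₁ e₂ e₃ P = sqClass (-1 : F) ∧
        twoDescentComponent W e₂ e₁ e₃ P = sqClass (-1 : F)) := by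
  rcases P with _ | ⟨x, y, hP⟩
  · exact Or.inl ⟨rfl, rfl⟩
  obtain ⟨h3, hx⟩ := e_le_x_of_equation h h₁₂ h₂₃ hP.1
  rcases hx with hx | hx
  · -- identity component
    left
    constructor
    · by_cases hx₁ : x = e₁
      · rw [twoDescentComponent_some_of_eq hP hx₁]
        exact sqClass_eq_one_of_pos hsq (mul_pos (by linarith) (by linarith))
      · rw [twoDescentComponent_some_of_ne hP hx₁]
        exact sqClass_eq_one_of_pos hsq (sub_pos.mpr (lt_of_le_of_ne hx (fun e ↦ hx₁ e.symm)))
    · rw [twoDescentComponent_some_of_ne hP (by intro he; linarith)]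
      exact sqClass_eq_one_of_pos hsq (by linarith)
  · -- the egg
    right
    constructor
    · rw [twoDescentComponent_some_of_ne hP (by intro he; linarith)]
      exact sqClass_eq_of_neg hsq (by linarith)
    · by_cases hx₂ : x = e₂
      · rw [twoDescentComponent_some_of_eq hP hx₂]
        exact sqClass_eq_of_neg hsq (mul_neg_of_neg_of_pos (by linarith) (by linarith))
      · rw [twoDescentComponent_some_of_ne hP hx₂]
        exact sqClass_eq_of_neg hsq (sub_neg.mpr (lt_of_le_of_ne hx hx₂))

omit [W.IsElliptic] in
/-- The `2`-descent image of `T₃ = (e₃, ·)` is `([−1], [−1])`. [cite: SilvermanAEC2009, Prop. X.1.4] -/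
theorem twoDescentComponent_T₃ (h₁₂ : e₂ < e₁) (h₂₃ : e₃ < e₂)
    (hsq : ∀ a : F, 0 < a → ∃ u : F, a = u ^ 2) {y₃ : F} (h₃ : W.Nonsingular e₃ y₃) :
    twoDescentComponent W e₁ e₂ e₃ (.some e₃ y₃ h₃) = sqClass (-1 : F) ∧
      twoDescentComponent W e₂ e₁ e₃ (.some e₃ y₃ h₃) = sqClass (-1 : F) := by
  rw [twoDescentComponent_some_of_ne h₃ (by intro he; linarith),
    twoDescentComponent_some_of_ne h₃ (by intro he; linarith)]
  exact ⟨sqClass_eq_of_neg hsq (by linarith), sqClass_eq_of_neg hsq (by linarith)⟩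

/-! ## §4. `E(F) = 2E(F) ∪ (2E(F) + T₃)` and `T₃ ∉ 2E(F)` -/

/-- **Every `F`-point is `2Q` or `2Q + T₃`** (`T₃ = (e₃, −(a₁e₃ + a₃)/2)` the point of order `2` with
the SMALLEST abscissa): if the `2`-descent image of `P` is trivial then `P ∈ 2E(F)` (tree
`exists_add_self_of_twoDescentComponent_eq_one`, the halving formula); otherwise it equals that of
`T₃`, so `P + T₃ ∈ 2E(F)`. Over `F = ℝ` this is "`E(ℝ)/2E(ℝ) ≅ ℤ/2` when `Δ > 0`"
(Milne *ADT* I Rem. 3.7). [cite: SilvermanAEC2009, Prop. X.1.4] [cite: MilneADT2006, I Rem. 3.7] -/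
theorem exists_add_self_or_add_self_add (h : W.SplitTwoTorsion e₁ e₂ e₃) (h₁₂ : e₂ < e₁)
    (h₂₃ : e₃ < e₂) (hsq : ∀ a : F, 0 < a → ∃ u : F, a = u ^ 2) (P : W.Point) :
    ∃ Q : W.Point, Q + Q = P ∨
      Q + Q = P + .some e₃ (W.twoTorsionY e₃) (nonsingular_twoTorsion h.swap₂₃.swap₁₂) := by
  set T₃ : W.Point := .some e₃ (W.twoTorsionY e₃) (nonsingular_twoTorsion h.swap₂₃.swap₁₂) with hT₃
  rcases twoDescentComponent_dichotomy h h₁₂ h₂₃ hsq P with ⟨hP₁, hP₂⟩ | ⟨hP₁, hP₂⟩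
  · obtain ⟨Q, hQ⟩ := exists_add_self_of_twoDescentComponent_eq_one h P hP₁ hP₂
    exact ⟨Q, Or.inl hQ⟩
  · obtain ⟨hT₁, hT₂⟩ := twoDescentComponent_T₃ h₁₂ h₂₃ hsq (nonsingular_twoTorsion h.swap₂₃.swap₁₂)
    have h1 : twoDescentComponent W e₁ e₂ e₃ (P + T₃) = 1 := by
      rw [twoDescentComponent_add h, hP₁, hT₃, hT₁, SqUnits.mul_self]
    have h2 : twoDescentComponent W e₂ e₁ e₃ (P + T₃) = 1 := by
      rw [twoDescentComponent_add h.swap₁₂, hP₂, hT₃, hT₂, SqUnits.mul_self]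
    obtain ⟨Q, hQ⟩ := exists_add_self_of_twoDescentComponent_eq_one h (P + T₃) h1 h2
    exact ⟨Q, Or.inr hQ⟩

/-- **Iterated halving: every `F`-point is `2ᵏQ` or `2ᵏQ + T₃`** (induction on `k`, using `2T₃ = O`):
the identity component `2E(F)` is `2`-divisible. [cite: MilneADT2006, I Rem. 3.7] -/
theorem exists_pow_smul_eq_or (h : W.SplitTwoTorsion e₁ e₂ e₃) (h₁₂ : e₂ < e₁) (h₂₃ : e₃ < e₂)
    (hsq : ∀ a : F, 0 < a → ∃ u : F, a = u ^ 2) (k : ℕ) (P : W.Point) :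
    ∃ Q : W.Point, (2 ^ k) • Q = P ∨
      (2 ^ k) • Q = P + .some e₃ (W.twoTorsionY e₃) (nonsingular_twoTorsion h.swap₂₃.swap₁₂) := by
  set T₃ : W.Point := .some e₃ (W.twoTorsionY e₃) (nonsingular_twoTorsion h.swap₂₃.swap₁₂) with hT₃
  have hT2 : T₃ + T₃ = 0 := add_self_of_Y_eq (negY_twoTorsionY e₃).symm
  induction k generalizing P with
  | zero => exact ⟨P, Or.inl (by rw [pow_zero, one_smul])⟩
  | succ k ih =>
    obtain ⟨Q₁, hQ₁⟩ := exists_add_self_or_add_self_add h h₁₂ h₂₃ hsq P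
    obtain ⟨Q, hQ⟩ := ih Q₁
    refine ⟨Q, ?_⟩
    have hk : (2 ^ (k + 1)) • Q = (2 ^ k) • Q + (2 ^ k) • Q := by
      rw [pow_succ, mul_nsmul', two_nsmul, smul_add]
    rw [hk]
    rcases hQ with hQ | hQ <;> rw [hQ]
    · rcases hQ₁ with h' | h'
      · exact Or.inl h'
      · exact Or.inr h'
    · have e : Q₁ + T₃ + (Q₁ + T₃) = Q₁ + Q₁ + (T₃ + T₃) := by abel
      rw [e, hT2, add_zero]
      rcases hQ₁ with h' | h'
      · exact Or.inl h'
      · exact Or.inr h'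

omit [DecidableEq F] in
/-- **`T₃ ∉ 2E(F)`**: doubling never lands below the abscissa `e₂ > e₃` (tree `add_self_ne_of_lt`, from
the duplication formula measured at a `2`-torsion abscissa). [cite: SilvermanAEC2009, III.2.3(d)] -/
theorem ne_add_self_T₃ [DecidableEq F] (h : W.SplitTwoTorsion e₁ e₂ e₃) (h₂₃ : e₃ < e₂) (Q : W.Point) :
    Q + Q ≠ .some e₃ (W.twoTorsionY e₃) (nonsingular_twoTorsion h.swap₂₃.swap₁₂) :=
  add_self_ne_of_lt W (equation_twoTorsion h.swap₁₂) (negY_twoTorsionY e₂).symm _ h₂₃ Q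

end RealClosed

end Summit.BirchSwinnertonDyer.BirchSwinnertonDyer.Theorems.MultTransportAtTwo

end
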